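import Literature.Computability.MetaComplexity.NWGenerator
import HarnessLib

/-!
# NW reconstruction with RANDOM advice: noticeable success probability (averaging)

Trunk `CplxMeta`, a small sibling of `NWGenerator.lean` (the hybrid argument of the Nisan–Wigderson
reconstruction: `sum_predictorAgreement_div` — over a uniformly random block `i` and uniform advice
`(z, w)` the NW predictor agrees with `f` with probability `1/2 + advantage/L` ON AVERAGE — and its
non-uniform consequence `exists_nwPredictor_agreement_ge`: SOME advice is good). The UNIFORM
reconstruction of Impagliazzo–Wigderson 1998 (Trevisan–Vadhan 2007, Lemma 3.5: from a distinguisher,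
a probabilistic polynomial-time oracle procedure "outputs with probability at least `…` a circuit
that computes `f` on a `1/2 + …` fraction of inputs"; Arora–Barak 2009, proof of Lemma 20.15 read
with random instead of optimal choices) cannot pick the best advice; it draws `(i, z, w)` at random.
What it needs is the averaging ("reverse Markov") step proved here:

* `frac_ge_of_avg_ge` — for `X ≤ 1` on a finite probability space with average `≥ 1/2 + δ`
  (`δ ≥ 0`), at least a `δ` fraction of the points have `X ≥ 1/2 + δ/2`;
* `avg_agreement_nwPredictor` — the average agreement over the triples `(i, z, w)` is exactly
  `1/2 + advantage/L` (repackaging of `sum_predictorAgreement_div`);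
* **`frac_good_advice_ge`** — hence at least an `advantage/L` fraction of the triples `(i, z, w)`
  give an NW predictor agreeing with `f` on `≥ 1/2 + advantage/(2L)` of the inputs.

Pure finite probability; no machines. (Consumer: the uniform half of the hardness-versus-randomness
theorem, `Complexity/UniformDerandomization*.lean`.)

## References

* R. Impagliazzo, A. Wigderson, *Randomness vs time: derandomization under a uniform assumption*,
  JCSS 63 (2001) 672–688 (FOCS 1998), §3 [ImpagliazzoWigderson2001].
* L. Trevisan, S. Vadhan, *Pseudorandomness and average-case complexity via uniform reductions*,
  Comput. Complexity 16 (2007) 331–364, Lemma 3.5 [TrevisanVadhan2007].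
* S. Arora, B. Barak, *Computational Complexity: A Modern Approach*, CUP 2009, proof of Lemma 20.15
  with Thm. 20.10 (Yao) [AroraBarakCC2009].
* M. Carmosino, R. Impagliazzo, V. Kabanets, A. Kolokolova, *Learning algorithms from natural proofs*,
  CCC 2016, Thm. 2.11 (NW reconstruction) [CarmosinoImpagliazzoKabanetsKolokolova2016].
-/

noncomputable section

namespace Literature.Computability.MetaComplexity

open Finset

/-! ### The averaging step -/

/-- **Averaging ("reverse Markov")**: if `X ≤ 1` pointwise on a finite nonempty space and the
average of `X` is at least `1/2 + δ` with `δ ≥ 0`, then at least a `δ` fraction of the points have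
`X ≥ 1/2 + δ/2`. (The good points contribute at most `1` each and the others at most `1/2 + δ/2`.)
[cite: AroraBarakCC2009, Lemma 20.15 (proof, averaging)] -/
theorem frac_ge_of_avg_ge {Ω : Type*} [Fintype Ω] [Nonempty Ω] (X : Ω → ℝ) (hX : ∀ ω, X ω ≤ 1)
    {δ : ℝ} (hδ : 0 ≤ δ) (havg : 1 / 2 + δ ≤ (∑ ω, X ω) / Fintype.card Ω) :
    δ ≤ ((univ.filter fun ω => 1 / 2 + δ / 2 ≤ X ω).card : ℝ) / Fintype.card Ω := by
  classical
  have hN : (0 : ℝ) < Fintype.card Ω := Nat.cast_pos.2 Fintype.card_pos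
  set G := univ.filter fun ω => 1 / 2 + δ / 2 ≤ X ω with hG
  set B := univ.filter fun ω => ¬ (1 / 2 + δ / 2 ≤ X ω) with hB
  have hsplit : ∑ ω, X ω = ∑ ω ∈ G, X ω + ∑ ω ∈ B, X ω :=
    (sum_filter_add_sum_filter_not univ (fun ω => 1 / 2 + δ / 2 ≤ X ω) X).symm
  have hcard : (G.card : ℝ) + B.card = Fintype.card Ω := by
    have h := Finset.card_filter_add_card_filter_not (s := (univ : Finset Ω)) (fun ω => 1 / 2 + δ / 2 ≤ X ω)
    rw [card_univ] at h
    exact_mod_cast h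
  have hGsum : ∑ ω ∈ G, X ω ≤ G.card := by
    have h := sum_le_card_nsmul G X 1 fun ω _ => hX ω
    rwa [nsmul_eq_mul, mul_one] at h
  have hBsum : ∑ ω ∈ B, X ω ≤ B.card * (1 / 2 + δ / 2) := by
    have h := sum_le_card_nsmul B X (1 / 2 + δ / 2) fun ω hω => by
      rw [hB, mem_filter] at hω
      exact (not_le.1 hω.2).le
    rwa [nsmul_eq_mul] at h
  rw [le_div_iff₀ hN] at havg ⊢
  have hGnn : (0 : ℝ) ≤ G.card := Nat.cast_nonneg _
  nlinarith [hsplit, hcard, hGsum, hBsum, hGnn]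

/-! ### The NW predictor with random advice -/

section NW

variable {α β : Type*} [Fintype α] [DecidableEq α] [Fintype β] [DecidableEq β] {L : ℕ}
variable (e : Fin L → (β ↪ α)) (f : (β → Bool) → Bool) (D : (Fin L → Bool) → Bool)

/-- **The average agreement over random advice**: over the triples `(i, z, w)` — block, outside
bits, hybrid string — the NW predictor agrees with `f` on average on exactly `1/2 + advantage/L` of
the inputs (`sum_predictorAgreement_div`, repackaged over the product space).
[cite: CarmosinoImpagliazzoKabanetsKolokolova2016, Thm. 2.11] [cite: AroraBarakCC2009, Lemma 20.15 (proof)] -/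
theorem avg_agreement_nwPredictor (hL : 0 < L) :
    (∑ t : Fin L × ((α → Bool) × (Fin L → Bool)), agreement (nwPredictor e f D t.1 t.2.1 t.2.2) f) /
        Fintype.card (Fin L × ((α → Bool) × (Fin L → Bool))) =
      1 / 2 + advantage D (nwGenerator e f) / L := by
  rw [← sum_predictorAgreement_div e f D hL, Fintype.sum_prod_type, Fintype.card_prod, Fintype.card_fin,
    Nat.cast_mul]
  simp only [predictorAgreement]
  rw [← sum_div, div_div, mul_comm]

/-- **Random advice is good with noticeable probability** (the uniform reading of the NW
reconstruction, Impagliazzo–Wigderson 1998 §3 / Trevisan–Vadhan 2007, Lemma 3.5): if `D` has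
advantage `ε ≥ 0` against the NW generator with `L > 0` outputs, then at least an `ε/L` fraction of
the triples `(i, z, w)` yield an NW predictor agreeing with `f` on at least a `1/2 + ε/(2L)` fraction
of the inputs. [cite: TrevisanVadhan2007, Lemma 3.5] [cite: ImpagliazzoWigderson2001, §3]
[cite: AroraBarakCC2009, Lemma 20.15 (proof)] -/
theorem frac_good_advice_ge (hL : 0 < L) (hadv : 0 ≤ advantage D (nwGenerator e f)) :
    advantage D (nwGenerator e f) / L ≤
      ((univ.filter fun t : Fin L × ((α → Bool) × (Fin L → Bool)) =>
          1 / 2 + advantage D (nwGenerator e f) / L / 2 ≤ agreement (nwPredictor e f D t.1 t.2.1 t.2.2) f).card : ℝ) /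
        Fintype.card (Fin L × ((α → Bool) × (Fin L → Bool))) := by
  haveI : Nonempty (Fin L) := ⟨⟨0, hL⟩⟩
  refine frac_ge_of_avg_ge (fun t : Fin L × ((α → Bool) × (Fin L → Bool)) =>
      agreement (nwPredictor e f D t.1 t.2.1 t.2.2) f) (fun t => ?_) (by positivity)
    (le_of_eq (avg_agreement_nwPredictor e f D hL).symm)
  -- agreements are at most `1`
  unfold agreement
  have hc : (0 : ℝ) < Fintype.card (β → Bool) := Nat.cast_pos.2 Fintype.card_pos
  rw [div_le_one hc, ← Finset.card_univ]
  exact_mod_cast card_filter_le _ _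

end NW

end Literature.Computability.MetaComplexity

end
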